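import Summits.CriticalPhenomena.PercolationContinuityZ3.Theorems.SahiMasterFamilyRigidityAllSystems

/-!
# Rigidity at every order, terminal configurations I: measure form of (GI), the `V_j = 2^E` obstruction, three or more active voters

Support file of the master-family programme (crux `NoHeavyLowerTail`, stmt-CriticalPhenomena-4575; cell `prim-masterthm`, seat P4,
unit `prim-masterthm-p4-g8`).  Seat document HOME/prim-masterthm-p4/RIGIDITY-ALLK.md §2 (STEP m ≥ 3, STEP m = 2 (i)–(ii)).  Fourth file.

* `GI.real_eq` — (GI) evaluated at a parameter vector `p`, in terms of `(prodBernoulli p).real`;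
* `Good.absurd_of_empty_mem` — in a good two-voter system with one active voter, the other voter cannot have `∅ ∈ V_j` (i.e. `V_j = 2^E`):
  `μ(A₁) + μ(Q₁) = μ(V₀) μ(Q₁) ≤ μ(Q₁)` is impossible;
* **`Good.absurd_three`** — the terminal configuration with `≥ 3` active voters is impossible: if every active set `A_j = V_j ∩ Q_j` is the `S`-cylinder
  of `ξ_j` and `Q_j` avoids the coordinates `S ∖ ξ_j`, then `μ_p(A_j) ≥ c^{|S|} μ_p(Q_j)` at `p ≡ c`, so (GI) gives `|J| c^{|S|} ≤ μ(V₀) ≤ 1`,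
  contradicting `c^{|S|} ≥ 1/2` for `c = 1 − 1/(2|S|+2)` (Bernoulli).
HONEST FRAMING: infrastructure; Sahi `C_k` / Kahn's Conj. 5 / the master theorem remain OPEN.  [this work]
-/

noncomputable section

open scoped Classical

namespace Summit.CriticalPhenomena.PercolationContinuityZ3.Theorems

open Finset Function MvPolynomial MeasureTheory
open Literature.Combinatorics.Sahi2008
open Literature.Probability.LatticeModels (prodBernoulli prodBernoulli_real_subset prodBernoulli_real_forall_notMem
  prodBernoulli_real_inter_of_determinedBy_disjoint)
open Literature.Probability.Percolation (DeterminedBy determinedBy_iff)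
open Literature.Probability.Percolation.BHK2006 (weight)
open Literature.Probability.Percolation.DecisionTree (ind ind_of_mem ind_of_not_mem ind_nonneg)
open SharedCoordinate (Ignores xInd)
open ExpectationRigidity RigidityR3

namespace RigidityAll

variable {ι : Type*} [Fintype ι] {κ : Type*}
variable {S : Finset ι} {J : Finset κ} {V₀ : Set (Set ι)} {V Q : κ → Set (Set ι)}

/-! ### (GI) in measure form -/

/-- **(GI) at the parameter vector `p`, in terms of `prodBernoulli p`.** [this work] -/
theorem GI.real_eq (h : GI J V₀ V Q) (p : ι → unitInterval) :
    ∑ j ∈ J, (prodBernoulli p).real (V j ∩ Q j) * ∏ l ∈ J.erase j, (prodBernoulli p).real (Q l) =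
      (prodBernoulli p).real V₀ * ∏ l ∈ J, (prodBernoulli p).real (Q l) := by
  have h1 := h.eval_eq (fun i => (p i : ℝ))
  have hw : weight (fun i => (p i : ℝ)) = bernoulliWeight p := rfl
  simp only [hw, ex_bernoulliWeight_ind] at h1
  exact h1

/-- Positivity of nonempty events at interior parameters (measure form). [this work] -/
theorem real_pos_of_nonempty {p : ι → unitInterval} (hp : ∀ i, (p i : ℝ) ∈ Set.Ioo (0 : ℝ) 1) {A : Set (Set ι)} (hA : A.Nonempty) :
    0 < (prodBernoulli p).real A := by
  rw [← ex_bernoulliWeight_ind]; exact ex_ind_pos hp hA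

/-- The constant parameter vector with value `c ∈ (0,1)`. [this work] -/
def cst (ι : Type*) {c : ℝ} (hc : c ∈ Set.Ioo (0 : ℝ) 1) : ι → unitInterval := fun _ => ⟨c, hc.1.le, hc.2.le⟩

omit [Fintype ι] in
/-- The constant parameter vector is interior. [this work] -/
theorem cst_mem_Ioo {c : ℝ} (hc : c ∈ Set.Ioo (0 : ℝ) 1) (i : ι) : ((cst ι hc i : unitInterval) : ℝ) ∈ Set.Ioo (0 : ℝ) 1 := hc

/-! ### The obstruction `∅ ∈ V_j` -/

/-- (GI) for two voters, unfolded. [this work] -/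
theorem GI.pair {j₁ j₂ : κ} (hne : j₁ ≠ j₂) (h : GI {j₁, j₂} V₀ V Q) :
    exPoly (ind (V j₁ ∩ Q j₁)) * exPoly (ind (Q j₂)) + exPoly (ind (V j₂ ∩ Q j₂)) * exPoly (ind (Q j₁)) =
      exPoly (ind V₀) * (exPoly (ind (Q j₁)) * exPoly (ind (Q j₂))) := by
  unfold GI at h
  have e1 : ({j₁, j₂} : Finset κ).erase j₁ = {j₂} := by
    rw [erase_insert_eq_erase, erase_eq_of_notMem (by simpa using hne)]
  have e2 : ({j₁, j₂} : Finset κ).erase j₂ = {j₁} := by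
    rw [pair_comm, erase_insert_eq_erase, erase_eq_of_notMem (by simpa using hne.symm)]
  rw [sum_pair hne, prod_pair hne, e1, e2, prod_singleton, prod_singleton] at h
  exact h

/-- **In a good two-voter system with voter `j₁` active, `∅ ∉ V_{j₂}`** (else `V_{j₂} = 2^E`, `μ(V_{j₂}|Q_{j₂}) ≡ 1` and
`μ(A₁)/μ(Q₁) = μ(V₀) − 1 ≤ 0`). [this work] -/
theorem Good.absurd_of_empty_mem {j₁ j₂ : κ} (h : Good S {j₁, j₂} V₀ V Q) (hne : j₁ ≠ j₂) (hact : (V j₁ ∩ Q j₁).Nonempty)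
    (h0 : (∅ : Set ι) ∈ V j₂) : False := by
  have hV2 : V j₂ = Set.univ := Set.eq_univ_of_forall fun ω => h.up j₂ (by simp) (Set.empty_subset ω) h0
  have hgi := GI.pair hne h.gi
  rw [hV2, Set.univ_inter] at hgi
  have hD2 : exPoly (ind (Q j₂)) ≠ 0 := exPoly_ind_ne_zero (h.ne j₂ (by simp))
  have key : exPoly (ind (V j₁ ∩ Q j₁)) + exPoly (ind (Q j₁)) = exPoly (ind V₀) * exPoly (ind (Q j₁)) := by
    apply mul_right_cancel₀ hD2
    linear_combination hgi
  have hc : (1 / 2 : ℝ) ∈ Set.Ioo (0 : ℝ) 1 := ⟨by norm_num, by norm_num⟩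
  set p : ι → unitInterval := cst ι hc with hp
  have hpi : ∀ i, (p i : ℝ) ∈ Set.Ioo (0 : ℝ) 1 := cst_mem_Ioo hc
  have hev := congrArg (MvPolynomial.eval fun i => (p i : ℝ)) key
  have hw : weight (fun i => (p i : ℝ)) = bernoulliWeight p := rfl
  simp only [map_add, map_mul, eval_exPoly, hw, ex_bernoulliWeight_ind] at hev
  have hA : 0 < (prodBernoulli p).real (V j₁ ∩ Q j₁) := real_pos_of_nonempty hpi hact
  have hQ : 0 < (prodBernoulli p).real (Q j₁) := real_pos_of_nonempty hpi (h.ne j₁ (by simp))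
  have hV : (prodBernoulli p).real V₀ ≤ 1 := measureReal_le_one
  nlinarith

/-! ### Cylinder events -/

/-- **Probability of an `S`-cylinder**: `μ_p({ω : ω ⊇ F, ω avoids G}) = μ_p(⊇ F) · μ_p(avoids G)` for disjoint `F, G`. [this work] -/
theorem real_supset_inter_avoid (p : ι → unitInterval) {F G : Finset ι} (hFG : Disjoint F G) :
    (prodBernoulli p).real ({ω : Set ι | (↑F : Set ι) ⊆ ω} ∩ {ω : Set ι | ∀ i ∈ G, i ∉ ω}) =
      (prodBernoulli p).real {ω : Set ι | (↑F : Set ι) ⊆ ω} * (prodBernoulli p).real {ω : Set ι | ∀ i ∈ G, i ∉ ω} := by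
  -- membership of a coordinate of `K` is decided by `ω ∩ K` (cf. `AdditiveGluingVar975.v975_det_subset`, not imported to keep the import graph light)
  have agree : ∀ {ω ω' : Set ι} {K : Set ι}, ω ∩ K = ω' ∩ K → ∀ {i : ι}, i ∈ K → (i ∈ ω ↔ i ∈ ω') :=
    fun h i hi => ⟨fun hω => ((Set.ext_iff.1 h i).1 ⟨hω, hi⟩).1, fun hω' => ((Set.ext_iff.1 h i).2 ⟨hω', hi⟩).1⟩
  have hF : DeterminedBy {ω : Set ι | (↑F : Set ι) ⊆ ω} (↑F : Set ι) := by
    rw [determinedBy_iff]; intro ω ω' h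
    simp only [Set.mem_setOf_eq, Set.subset_def]
    exact forall₂_congr fun m hm => agree h hm
  have hG : DeterminedBy {ω : Set ι | ∀ i ∈ G, i ∉ ω} (↑G : Set ι) := by
    rw [determinedBy_iff]; intro ω ω' h
    exact forall₂_congr fun m hm => not_congr (agree h (mem_coe.2 hm))
  exact prodBernoulli_real_inter_of_determinedBy_disjoint p hFG hF hG MeasurableSet.of_discrete MeasurableSet.of_discrete

omit [Fintype ι] in
/-- `μ_p(⊇ F) = c^{|F|}` at the constant parameter `c`. [this work] -/
theorem real_supset_cst {c : ℝ} (hc : c ∈ Set.Ioo (0 : ℝ) 1) (F : Finset ι) :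
    (prodBernoulli (cst ι hc)).real {ω : Set ι | (↑F : Set ι) ⊆ ω} = c ^ F.card := by
  rw [prodBernoulli_real_subset]
  exact prod_const c

/-! ### Three or more active voters -/

/-- Bernoulli: `(1 − 1/(2n+2))^n ≥ 1/2`. [folklore] -/
theorem half_le_pow (n : ℕ) : (1 / 2 : ℝ) ≤ (1 - 1 / (2 * (n + 1))) ^ n := by
  have h := one_add_mul_le_pow (show (-2 : ℝ) ≤ -(1 / (2 * (n + 1))) by
    have : (0 : ℝ) < 2 * (n + 1) := by positivity
    have : 1 / (2 * ((n : ℝ) + 1)) ≤ 1 := by rw [div_le_one this]; linarith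
    linarith) n
  have hn : (1 : ℝ) + n * -(1 / (2 * (n + 1))) ≥ 1 / 2 := by
    have hpos : (0 : ℝ) < 2 * (n + 1) := by positivity
    rw [ge_iff_le, show (1 : ℝ) + n * -(1 / (2 * (n + 1))) = 1 - n / (2 * (n + 1)) by ring]
    rw [le_sub_iff_add_le, show (1 : ℝ) / 2 + n / (2 * (n + 1)) = (2 * n + 1) / (2 * (n + 1)) by field_simp; ring,
      div_le_one hpos]
    linarith
  have : (1 : ℝ) + -(1 / (2 * (n + 1))) = 1 - 1 / (2 * (n + 1)) := by ring
  rw [this] at h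
  linarith

/-- **STEP m ≥ 3 of THEOREM R*: the terminal configuration with three or more active voters is impossible.** [this work] -/
theorem Good.absurd_three (h : Good S J V₀ V Q) (ξ : κ → Finset ι) (hξ : ∀ j ∈ J, ξ j ⊆ S)
    (hA : ∀ j ∈ J, ∀ ω ∈ V j ∩ Q j, ∀ x ∈ S, x ∈ ω ↔ x ∈ ξ j)
    (hQZ : ∀ j ∈ J, ∀ ω ∈ Q j, ∀ x ∈ S, x ∉ ξ j → x ∉ ω)
    (hact : ∀ j ∈ J, (V j ∩ Q j).Nonempty) (hcard : 3 ≤ J.card) : False := by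
  set n := S.card with hn
  have hc : (1 - 1 / (2 * ((n : ℝ) + 1))) ∈ Set.Ioo (0 : ℝ) 1 := by
    have hpos : (0 : ℝ) < 2 * (n + 1) := by positivity
    constructor
    · rw [sub_pos, div_lt_one hpos]; linarith
    · have : (0 : ℝ) < 1 / (2 * (n + 1)) := by positivity
      linarith
  set c : ℝ := 1 - 1 / (2 * ((n : ℝ) + 1)) with hcdef
  set p : ι → unitInterval := cst ι hc with hp
  have hpi : ∀ i, (p i : ℝ) ∈ Set.Ioo (0 : ℝ) 1 := cst_mem_Ioo hc
  set P : Set (Set ι) → ℝ := fun A => (prodBernoulli p).real A with hP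
  have hgi := h.gi.real_eq p
  have ht : (1 / 2 : ℝ) ≤ c ^ n := half_le_pow n
  -- lower bound `c^n · P(Q_j) ≤ P(A_j)`
  have hlow : ∀ j ∈ J, c ^ n * P (Q j) ≤ P (V j ∩ Q j) := by
    intro j hj
    set Up : Set (Set ι) := {ω | (↑(ξ j) : Set ι) ⊆ ω} with hUp
    set Z : Set (Set ι) := {ω | ∀ i ∈ S \ ξ j, i ∉ ω} with hZ
    -- the cylinder `Up ∩ Z` lies in `A_j`
    have hcyl : Up ∩ Z ⊆ V j ∩ Q j := by
      intro ω hω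
      obtain ⟨ω₀, hω₀⟩ := hact j hj
      have heq : ω ∩ ↑S = ω₀ ∩ ↑S := by
        ext i
        simp only [Set.mem_inter_iff, mem_coe]
        constructor
        · rintro ⟨hi, hiS⟩
          refine ⟨(hA j hj ω₀ hω₀ i hiS).2 ?_, hiS⟩
          by_contra hiξ
          exact hω.2 i (mem_sdiff.2 ⟨hiS, hiξ⟩) hi
        · rintro ⟨hi, hiS⟩
          exact ⟨hω.1 (mem_coe.2 ((hA j hj ω₀ hω₀ i hiS).1 hi)), hiS⟩
      exact ⟨(mem_iff_of_inter_eq (h.freeV j hj) heq).2 hω₀.1, (mem_iff_of_inter_eq (h.freeQ j hj) heq).2 hω₀.2⟩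
    have hQsub : Q j ⊆ Z := fun ω hω i hi => hQZ j hj ω hω i (mem_sdiff.1 hi).1 (mem_sdiff.1 hi).2
    have hUpval : P Up = c ^ (ξ j).card := real_supset_cst hc (ξ j)
    have hprod : P (Up ∩ Z) = P Up * P Z := real_supset_inter_avoid p disjoint_sdiff
    have hZnn : 0 ≤ P Z := measureReal_nonneg
    have hcn : c ^ n ≤ c ^ (ξ j).card := pow_le_pow_of_le_one hc.1.le hc.2.le (card_le_card (hξ j hj))
    calc c ^ n * P (Q j) ≤ c ^ n * P Z := mul_le_mul_of_nonneg_left (measureReal_mono hQsub) (pow_nonneg hc.1.le n)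
      _ ≤ c ^ (ξ j).card * P Z := mul_le_mul_of_nonneg_right hcn hZnn
      _ = P (Up ∩ Z) := by rw [hprod, hUpval]
      _ ≤ P (V j ∩ Q j) := measureReal_mono hcyl
  -- the contradiction `|J| · c^n · Πq ≤ P(V₀) · Πq ≤ Πq`
  have hq : ∀ l ∈ J, 0 < P (Q l) := fun l hl => real_pos_of_nonempty hpi (h.ne l hl)
  have hprodpos : 0 < ∏ l ∈ J, P (Q l) := prod_pos hq
  have hle : (J.card : ℝ) * c ^ n * ∏ l ∈ J, P (Q l) ≤ P V₀ * ∏ l ∈ J, P (Q l) := by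
    calc (J.card : ℝ) * c ^ n * ∏ l ∈ J, P (Q l) = ∑ j ∈ J, c ^ n * ∏ l ∈ J, P (Q l) := by
          rw [sum_const, nsmul_eq_mul]; ring
      _ = ∑ j ∈ J, c ^ n * P (Q j) * ∏ l ∈ J.erase j, P (Q l) :=
          sum_congr rfl fun j hj => by rw [mul_assoc, mul_prod_erase J (fun l => P (Q l)) hj]
      _ ≤ ∑ j ∈ J, P (V j ∩ Q j) * ∏ l ∈ J.erase j, P (Q l) :=
          sum_le_sum fun j hj => mul_le_mul_of_nonneg_right (hlow j hj) (prod_nonneg fun l _ => measureReal_nonneg)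
      _ = P V₀ * ∏ l ∈ J, P (Q l) := hgi
  have hV : P V₀ ≤ 1 := measureReal_le_one
  have h1 : (J.card : ℝ) * c ^ n ≤ 1 := by
    have := le_trans hle (mul_le_of_le_one_left hprodpos.le hV)
    exact le_of_mul_le_mul_right (by linarith) hprodpos
  have h3 : (3 : ℝ) ≤ J.card := by exact_mod_cast hcard
  nlinarith

end RigidityAll

end Summit.CriticalPhenomena.PercolationContinuityZ3.Theorems
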